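import Literature.Analysis.FluidPDE.LocalEnergyConcatenation
import Literature.Analysis.FluidPDE.LeraySuitableWeakSolutions

/-!
# Crux `SelfMixingDichotomy.SequentialTypeIExclusion` (stmt-NavierStokesRegularity-1424), line `registered` (r4):
  STUB `stub_continuationPastFinalTime` — a local energy solution whose final slice has finite energy continues
  past its final time

Helper file (`--supports stmt-NavierStokesRegularity-1424`) proving the registered stub
`stub_continuationPastFinalTime` of the r4 skeleton (`Cruxes/SequentialTypeIExclusion/Lines/birth.lean`):

> a local energy solution `(v, π)` of Navier–Stokes (`ν = 1`) on `ℝ³ × (0, T)` in Seregin's class Def. B.1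
> (`IsLocalEnergySolutionOn T 1 v₀ v π`) whose FINAL slice `v T` has finite energy extends to a local energy
> solution `(U, P)` on `ℝ³ × (0, T + 1)` with the same datum, agreeing with `(v, π)` on `[0, T]`.

Proof (Leray 1934, weak continuation; Lemarié-Rieusset 2016, Thm. 14.8 proof Step 2; Seregin 2014, App. B §B.5):
the final slice is weakly divergence-free (`IsLocalEnergySolutionOn.integral_inner_gradient_slice_eq_zero` at
`t = T`, by the weak continuity (B.1.6) on the CLOSED interval), so Leray's construction restarts a global weak
Leray–Hopf solution from it which is a local energy solution on every finite strip
(`exists_isGlobalLerayHopf_and_isLocalEnergySolutionOn`); the concatenation AT THE FINAL SLICE `t₀ = T` is a local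
energy solution on `(0, T + 1)` (`IsLocalEnergySolutionOn.exists_extension_of_slice_of_le`, the `t₀ ≤ T` form of the
tree's concatenation theorem: the junction needs only the weak continuity on `[0, T]`, the weak form and the local
energy inequality AT the slice `T`). No uniqueness theorem enters.
-/

noncomputable section

-- the summit and its single problem share the name (D-0017 nested layout)
set_option linter.dupNamespace false

namespace Summit.NavierStokesRegularity.NavierStokesRegularity.Theorems.SequentialTypeIExclusion.Registered

open scoped ENNReal NNReal Topology
open Literature.Analysis.FluidPDE Set Filter MeasureTheory Function Metric

/-- **STUB `stub_continuationPastFinalTime` (r4) — continuation of a local energy solution past its final time,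
when the final slice has finite energy** (Leray 1934; Lemarié-Rieusset 2016, Thm. 14.8 proof Step 2; Seregin 2014,
App. B §B.5). For every `T > 0`, every local energy solution `(v, π)` (`ν = 1`) on `ℝ³ × (0, T)` with datum `v₀`
(Seregin's class Def. B.1) such that `v T ∈ L²(ℝ³)` admits a local energy solution `(U, P)` on `ℝ³ × (0, T + 1)` with
datum `v₀` and `U t = v t`, `P t = π t` for all `t ∈ [0, T]`. -/
theorem stub_continuationPastFinalTime :
    ∀ T : ℝ, 0 < T →
      ∀ (v₀ : EuclideanSpace ℝ (Fin 3) → EuclideanSpace ℝ (Fin 3))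
        (v : ℝ → EuclideanSpace ℝ (Fin 3) → EuclideanSpace ℝ (Fin 3))
        (π : ℝ → EuclideanSpace ℝ (Fin 3) → ℝ),
        Literature.Analysis.FluidPDE.IsLocalEnergySolutionOn T 1 v₀ v π →
        MeasureTheory.MemLp (v T) 2 MeasureTheory.volume →
        ∃ (U : ℝ → EuclideanSpace ℝ (Fin 3) → EuclideanSpace ℝ (Fin 3))
          (P : ℝ → EuclideanSpace ℝ (Fin 3) → ℝ),
          Literature.Analysis.FluidPDE.IsLocalEnergySolutionOn (T + 1) 1 v₀ U P ∧
          ∀ t ∈ Set.Icc 0 T, U t = v t ∧ P t = π t := by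
  intro T hT v₀ v π hv hmem
  -- the final slice is weakly divergence-free (weak continuity on the closed interval)
  have hdiv : IsWeaklyDivFree (v T) := fun θ hθ =>
    hv.integral_inner_gradient_slice_eq_zero hT hθ ⟨hT.le, le_rfl⟩
  -- Leray's weak continuation from the final slice: Leray–Hopf + local energy solution on every strip
  obtain ⟨w, q, -, -, -, -, -, -, hwq⟩ :=
    exists_isGlobalLerayHopf_and_isLocalEnergySolutionOn one_pos hmem hdiv
  -- concatenate at the final slice `t₀ = T`
  exact hv.exists_extension_of_slice_of_le hT le_rfl one_pos ⟨w, q, hwq 1 one_pos⟩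

end Summit.NavierStokesRegularity.NavierStokesRegularity.Theorems.SequentialTypeIExclusion.Registered

end
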